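import Summits.BirchSwinnertonDyer.Rank1Residual.X10.UnitRoad
import HarnessLib

/-!
# Class X10b (N2), the UNIT ROAD at `p = 3`: per-pair kernel RECORDS, part F — X_A3
# (`MazurMainConjecture W 3`) AT THE PAIR for 7 N2 cells with trivial `3`-primary arithmetic
# (72839d1, 128018a1, 131648bi1, 132496bh1, 132496v1, 148382l1, 149248c1) (cell `b2b-bsdres`, unit `b2b-bsdres-x10` = N2 class lead, gen 24)

HONEST FRAMING (run/shared/lean/b2b/bsd-rank1-residual/, verbatim in every file): the goal of the
cell is to DELETE the COMBINATION-SHAPED residual classes of the Birch–Swinnerton-Dyer formula for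
ALL analytic-rank `≤ 1` elliptic curves over `ℚ` — "full BSD formula for every rank `≤ 1` curve in
class `C`" assembled STRICTLY from published theorems — so that the rank-`≤ 1` remainder becomes
exactly the CONSTRUCTION-SHAPED classes, which are TYPED (missing-input `Prop`s), NOT attempted.
This is not "finishing BSD". Theorems only; NO definition, NO named fact; class X10b keeps its label
CONSTRUCTION-SHAPED (NEEDS X_A3, referee R82.3 / RESIDUAL-MAP §I N2); nothing is booked by this file
(the lane books, the referee rules); everything is PER PAIR; no census number moves.

## What (x10 GEN 24, X10-AUDIT §30; `class-closure/N2/LAMBDA-SUBPARTITION-x10g24.md`)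

For each cell `E` below — an N2 cell of record (`class-closure/N2/pairs.tsv`; `p = 3` good ordinary,
`E[3]` irreducible with image a Cartan normaliser, census image type in the record's docstring) of
analytic rank `0` with TRIVIAL `3`-PRIMARY ARITHMETIC in Cremona's table (`a₃ ≢ 1 (mod 3)`,
`3 ∤ ∏ c_ℓ`, `3 ∤ #Ш_an`, `#E(ℚ)_tors` prime to `3`) — the record
`mazurMainConjecture_unit_u<label>` is the cell's typed missing input X_A3 AT THE PAIR,
`MazurMainConjecture W 3` (`W` any globally minimal curve whose integral model is Cremona's), from
`UnitRoad.mazurMainConjecture_three_of_ainvs_of_trivialArithmetic` (x10 gen 24; = x9 gen 5's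
`mazurMainConjecture_with_mu_zero_of_trivialArithmetic_odd` read off the integer model) with, IN THE
KERNEL: `3 ∤ Δ`, `#Ẽ(𝔽₃) = n₃` (`decide`; `3 ∤ 4 − n₃`: ordinary; `3 ∤ n₃`: NON-ANOMALOUS), and a
Frobenius witness `ℓ` (`#Ẽ(𝔽_ℓ) = n`, `X² − (ℓ+1−n)X + ℓ` root-free mod `3`: `E[3]` irreducible,
Mazur 1978 Prop. 6.3 (1)). DISPLAYED binders: PUBLISHED `hkato` (Kato 2004 Thm. 17.4 (1)), `hGr`
(Greenberg 1999 Thm. 4.1), `h5`/`h3` (period unit); CENSUS `htam : 3 ∤ ∏ c_ℓ(E)`,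
`hL : L(E,1)/Ω_E` a nonzero rational `3`-adic unit, `hSel : #Sel_{3^∞}(E/ℚ) = 1` (Cremona `allbsd`:
rank `0`, `∏ c_ℓ`, `#Ш_an`, `#E(ℚ)_tors` as quoted per record; the lane's `3`-descent certificate
`dim Sel₃(E) = 0` where on file); instance binders `[W.IsElliptic] [W.IsGloballyMinimal]`. NO
Greenberg–Vatsal, NO Rubin, NO Yan–Zhu, NO `μ`-certificate, NO CM partner. READING: at these pairs the
main conjecture is a triviality (unit `3`-adic `L`-function, `X(E/ℚ_∞)` of unit characteristic series);
the class-level statement and the 138 ANOMALOUS cells are untouched. Data script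
`HOME/b2b-bsdres-x10/g24/gen/{unitdata,mkrecords}.py` (stdlib; Cremona ecdata).

References: K. Kato, Astérisque 295 (2004) Thm. 17.4 (1) [Kato2004Asterisque]; R. Greenberg, LNM
1716 (1999) Thm. 4.1, Prop. 3.8 [GreenbergLNM1716]; B. Mazur, Invent. Math. 44 (1978) Prop. 6.3 (1)
[Mazur1978]; J. E. Cremona, *Algorithms for Modular Elliptic Curves*, tables [Cremona2006].
-/

set_option autoImplicit false

noncomputable section

open scoped Classical MatrixGroups ModularForm

open CongruenceSubgroup WeierstrassCurve Literature.NumberTheory.EllipticCurves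
  Literature.NumberTheory.EllipticCurves.ModularForms Literature.NumberTheory.EllipticCurves.Rank1Residual
  Literature.NumberTheory.EllipticCurves.Rank1Residual.X11RankOneCertificates
  Summit.BirchSwinnertonDyer.BirchSwinnertonDyer.Rank1Residual.IntModel
  Summit.BirchSwinnertonDyer.BirchSwinnertonDyer.Rank1Residual.X11RankOne
  Summit.BirchSwinnertonDyer.BirchSwinnertonDyer.Theorems.Rank1ResidualX1Defs

namespace Summit.BirchSwinnertonDyer.Rank1Residual.X10.UnitRoad

/-! ### `72839d1` (3Ns, N = 72839) -/

/-- `#Ẽ(𝔽_{3}) = 5` (`a₃ = -1`: good ORDINARY and NON-ANOMALOUS at `3`) for Cremona's model `72839d1` (kernel count). [folklore] -/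
theorem card_u72839d1_3 :
    Nat.card (((⟨0, (-1), 1, (-8619563), 9743356560⟩ : WeierstrassCurve ℤ).map (Int.castRingHom (ZMod 3))).toAffine.Point) = 5 := by
  rw [@WeierstrassCurve.natCard_point_eq_one_add_card (ZMod 3) (@ZMod.instField 3 ⟨by norm_num⟩) _ _ _
    (by decide +kernel), @card_sol_eq_sum_euler (ZMod 3) (@ZMod.instField 3 ⟨by norm_num⟩) _ _
    (by rw [ZMod.ringChar_zmod_n]; decide), ZMod.card]
  decide +kernel

/-- `#Ẽ(𝔽_{7}) = 11` (`a_{7} = -3`; `X² − a_{7}X + 7` root-free mod `3`) for Cremona's model `72839d1` (kernel count). [folklore] -/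
theorem card_u72839d1_7 :
    Nat.card (((⟨0, (-1), 1, (-8619563), 9743356560⟩ : WeierstrassCurve ℤ).map (Int.castRingHom (ZMod 7))).toAffine.Point) = 11 := by
  rw [@WeierstrassCurve.natCard_point_eq_one_add_card (ZMod 7) (@ZMod.instField 7 ⟨by norm_num⟩) _ _ _
    (by decide +kernel), @card_sol_eq_sum_euler (ZMod 7) (@ZMod.instField 7 ⟨by norm_num⟩) _ _
    (by rw [ZMod.ringChar_zmod_n]; decide), ZMod.card]
  decide +kernel

/-- **X_A3 AT THE PAIR `(72839d1, 3)` by the UNIT ROAD: `MazurMainConjecture W 3`.** Cremona model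
`[0, -1, 1, -8619563, 9743356560]`, `N = 72839 = 13^2 · 431`; census image `Ns` (split Cartan normaliser `3Ns`); `#Ẽ(𝔽₃) = 5`, `a₃ = -1` (good
ORDINARY, NON-ANOMALOUS); Frobenius witness `ℓ = 7`: `#Ẽ(𝔽_{7}) = 11`, `a_{7} = -3`, `X² − a_{7}X + 7`
root-free mod `3` (`E[3]` irreducible). Cremona `allbsd`: analytic rank `0`, `#E(ℚ)_tors = 1`,
`∏ c_ℓ = 2`, `#Ш_an = 1` (so `L(E,1)/Ω_E = 2`, a `3`-adic unit). Displayed binders: PUBLISHED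
`hkato`, `hGr`, `h5`, `h3`; census `htam`, `hL`, `hSel`. Per pair; the class-level statement stays OPEN;
nothing booked. [cite: Kato2004Asterisque, Thm. 17.4 (1) (p. 273)] [cite: GreenbergLNM1716, Thm. 4.1 (p. 102) and Prop. 3.8 (p. 95)]
[cite: Mazur1978, §6 Prop. 6.3 (1) (p. 153)] [cite: Cremona2006, Table 1 (Cremona label 72839d1)] -/
theorem mazurMainConjecture_unit_u72839d1
    (hkato : ∀ (W : WeierstrassCurve ℚ) [W.IsElliptic] [W.IsGloballyMinimal] (p : ℕ) [Fact p.Prime]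
      (κ : ZpExtension ℚ p) (γ : Field.absoluteGaloisGroup ℚ) (N : ℕ) [NeZero N]
      (f : CuspForm (Gamma0 N) 2), kato_divisibility W p (κ := κ) (γ := γ) (f := f))
    (hGr : greenberg_charValue_rankZero) (h5 : realPeriodRat_eq_unit_mul_plusPeriod)
    (h3 : realPeriodRat_eq_unit_mul_plusPeriod_three)
    (W : WeierstrassCurve ℚ) [W.IsElliptic] [W.IsGloballyMinimal] [Fact (Nat.Prime 3)]
    (hI : integralModelInt W = ⟨0, (-1), 1, (-8619563), 9743356560⟩)
    (htam : ¬ 3 ∣ W.tamagawaProduct)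
    (hL : ∃ q : ℚ, q ≠ 0 ∧ W.entireLFunction 1 / (W.realPeriodRat : ℂ) = (q : ℂ) ∧ padicValRat 3 q = 0)
    (hSel : Nat.card (W.selmerGroupPInfty 3) = 1) :
    MazurMainConjecture W 3 :=
  haveI : Fact (Nat.Prime 7) := ⟨by norm_num⟩
  mazurMainConjecture_three_of_ainvs_of_trivialArithmetic hkato hGr h5 h3 0 (-1) 1 (-8619563) 9743356560 hI
    7 11 5 (by decide +kernel) card_u72839d1_3 (by decide) (by decide) (by decide) (by decide +kernel)
    card_u72839d1_7 (by decide +kernel) htam hL hSel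

/-! ### `128018a1` (3Ns, N = 128018) -/

/-- `#Ẽ(𝔽_{3}) = 2` (`a₃ = 2`: good ORDINARY and NON-ANOMALOUS at `3`) for Cremona's model `128018a1` (kernel count). [folklore] -/
theorem card_u128018a1_3 :
    Nat.card (((⟨1, 1, 0, (-1072029), 25635581⟩ : WeierstrassCurve ℤ).map (Int.castRingHom (ZMod 3))).toAffine.Point) = 2 := by
  rw [@WeierstrassCurve.natCard_point_eq_one_add_card (ZMod 3) (@ZMod.instField 3 ⟨by norm_num⟩) _ _ _
    (by decide +kernel), @card_sol_eq_sum_euler (ZMod 3) (@ZMod.instField 3 ⟨by norm_num⟩) _ _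
    (by rw [ZMod.ringChar_zmod_n]; decide), ZMod.card]
  decide +kernel

/-- `#Ẽ(𝔽_{7}) = 5` (`a_{7} = 3`; `X² − a_{7}X + 7` root-free mod `3`) for Cremona's model `128018a1` (kernel count). [folklore] -/
theorem card_u128018a1_7 :
    Nat.card (((⟨1, 1, 0, (-1072029), 25635581⟩ : WeierstrassCurve ℤ).map (Int.castRingHom (ZMod 7))).toAffine.Point) = 5 := by
  rw [@WeierstrassCurve.natCard_point_eq_one_add_card (ZMod 7) (@ZMod.instField 7 ⟨by norm_num⟩) _ _ _
    (by decide +kernel), @card_sol_eq_sum_euler (ZMod 7) (@ZMod.instField 7 ⟨by norm_num⟩) _ _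
    (by rw [ZMod.ringChar_zmod_n]; decide), ZMod.card]
  decide +kernel

/-- **X_A3 AT THE PAIR `(128018a1, 3)` by the UNIT ROAD: `MazurMainConjecture W 3`.** Cremona model
`[1, 1, 0, -1072029, 25635581]`, `N = 128018 = 2 · 11^2 · 23^2`; census image `Ns` (split Cartan normaliser `3Ns`); `#Ẽ(𝔽₃) = 2`, `a₃ = 2` (good
ORDINARY, NON-ANOMALOUS); Frobenius witness `ℓ = 7`: `#Ẽ(𝔽_{7}) = 5`, `a_{7} = 3`, `X² − a_{7}X + 7`
root-free mod `3` (`E[3]` irreducible). Cremona `allbsd`: analytic rank `0`, `#E(ℚ)_tors = 1`,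
`∏ c_ℓ = 8`, `#Ш_an = 1` (so `L(E,1)/Ω_E = 8`, a `3`-adic unit); not among the 257 lane-open cells of the g19 closure map (closed earlier by the lane) — a cell of record of N2 all the same. Displayed binders: PUBLISHED
`hkato`, `hGr`, `h5`, `h3`; census `htam`, `hL`, `hSel`. Per pair; the class-level statement stays OPEN;
nothing booked. [cite: Kato2004Asterisque, Thm. 17.4 (1) (p. 273)] [cite: GreenbergLNM1716, Thm. 4.1 (p. 102) and Prop. 3.8 (p. 95)]
[cite: Mazur1978, §6 Prop. 6.3 (1) (p. 153)] [cite: Cremona2006, Table 1 (Cremona label 128018a1)] -/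
theorem mazurMainConjecture_unit_u128018a1
    (hkato : ∀ (W : WeierstrassCurve ℚ) [W.IsElliptic] [W.IsGloballyMinimal] (p : ℕ) [Fact p.Prime]
      (κ : ZpExtension ℚ p) (γ : Field.absoluteGaloisGroup ℚ) (N : ℕ) [NeZero N]
      (f : CuspForm (Gamma0 N) 2), kato_divisibility W p (κ := κ) (γ := γ) (f := f))
    (hGr : greenberg_charValue_rankZero) (h5 : realPeriodRat_eq_unit_mul_plusPeriod)
    (h3 : realPeriodRat_eq_unit_mul_plusPeriod_three)
    (W : WeierstrassCurve ℚ) [W.IsElliptic] [W.IsGloballyMinimal] [Fact (Nat.Prime 3)]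
    (hI : integralModelInt W = ⟨1, 1, 0, (-1072029), 25635581⟩)
    (htam : ¬ 3 ∣ W.tamagawaProduct)
    (hL : ∃ q : ℚ, q ≠ 0 ∧ W.entireLFunction 1 / (W.realPeriodRat : ℂ) = (q : ℂ) ∧ padicValRat 3 q = 0)
    (hSel : Nat.card (W.selmerGroupPInfty 3) = 1) :
    MazurMainConjecture W 3 :=
  haveI : Fact (Nat.Prime 7) := ⟨by norm_num⟩
  mazurMainConjecture_three_of_ainvs_of_trivialArithmetic hkato hGr h5 h3 1 1 0 (-1072029) 25635581 hI
    7 5 2 (by decide +kernel) card_u128018a1_3 (by decide) (by decide) (by decide) (by decide +kernel)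
    card_u128018a1_7 (by decide +kernel) htam hL hSel

/-! ### `131648bi1` (3Ns, N = 131648) -/

/-- `#Ẽ(𝔽_{3}) = 2` (`a₃ = 2`: good ORDINARY and NON-ANOMALOUS at `3`) for Cremona's model `131648bi1` (kernel count). [folklore] -/
theorem card_u131648bi1_3 :
    Nat.card (((⟨0, (-1), 0, 147, (-757)⟩ : WeierstrassCurve ℤ).map (Int.castRingHom (ZMod 3))).toAffine.Point) = 2 := by
  rw [@WeierstrassCurve.natCard_point_eq_one_add_card (ZMod 3) (@ZMod.instField 3 ⟨by norm_num⟩) _ _ _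
    (by decide +kernel), @card_sol_eq_sum_euler (ZMod 3) (@ZMod.instField 3 ⟨by norm_num⟩) _ _
    (by rw [ZMod.ringChar_zmod_n]; decide), ZMod.card]
  decide +kernel

/-- `#Ẽ(𝔽_{7}) = 5` (`a_{7} = 3`; `X² − a_{7}X + 7` root-free mod `3`) for Cremona's model `131648bi1` (kernel count). [folklore] -/
theorem card_u131648bi1_7 :
    Nat.card (((⟨0, (-1), 0, 147, (-757)⟩ : WeierstrassCurve ℤ).map (Int.castRingHom (ZMod 7))).toAffine.Point) = 5 := by
  rw [@WeierstrassCurve.natCard_point_eq_one_add_card (ZMod 7) (@ZMod.instField 7 ⟨by norm_num⟩) _ _ _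
    (by decide +kernel), @card_sol_eq_sum_euler (ZMod 7) (@ZMod.instField 7 ⟨by norm_num⟩) _ _
    (by rw [ZMod.ringChar_zmod_n]; decide), ZMod.card]
  decide +kernel

/-- **X_A3 AT THE PAIR `(131648bi1, 3)` by the UNIT ROAD: `MazurMainConjecture W 3`.** Cremona model
`[0, -1, 0, 147, -757]`, `N = 131648 = 2^6 · 11^2 · 17`; census image `Ns` (split Cartan normaliser `3Ns`); `#Ẽ(𝔽₃) = 2`, `a₃ = 2` (good
ORDINARY, NON-ANOMALOUS); Frobenius witness `ℓ = 7`: `#Ẽ(𝔽_{7}) = 5`, `a_{7} = 3`, `X² − a_{7}X + 7`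
root-free mod `3` (`E[3]` irreducible). Cremona `allbsd`: analytic rank `0`, `#E(ℚ)_tors = 1`,
`∏ c_ℓ = 2`, `#Ш_an = 1` (so `L(E,1)/Ω_E = 2`, a `3`-adic unit); not among the 257 lane-open cells of the g19 closure map (closed earlier by the lane) — a cell of record of N2 all the same. Displayed binders: PUBLISHED
`hkato`, `hGr`, `h5`, `h3`; census `htam`, `hL`, `hSel`. Per pair; the class-level statement stays OPEN;
nothing booked. [cite: Kato2004Asterisque, Thm. 17.4 (1) (p. 273)] [cite: GreenbergLNM1716, Thm. 4.1 (p. 102) and Prop. 3.8 (p. 95)]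
[cite: Mazur1978, §6 Prop. 6.3 (1) (p. 153)] [cite: Cremona2006, Table 1 (Cremona label 131648bi1)] -/
theorem mazurMainConjecture_unit_u131648bi1
    (hkato : ∀ (W : WeierstrassCurve ℚ) [W.IsElliptic] [W.IsGloballyMinimal] (p : ℕ) [Fact p.Prime]
      (κ : ZpExtension ℚ p) (γ : Field.absoluteGaloisGroup ℚ) (N : ℕ) [NeZero N]
      (f : CuspForm (Gamma0 N) 2), kato_divisibility W p (κ := κ) (γ := γ) (f := f))
    (hGr : greenberg_charValue_rankZero) (h5 : realPeriodRat_eq_unit_mul_plusPeriod)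
    (h3 : realPeriodRat_eq_unit_mul_plusPeriod_three)
    (W : WeierstrassCurve ℚ) [W.IsElliptic] [W.IsGloballyMinimal] [Fact (Nat.Prime 3)]
    (hI : integralModelInt W = ⟨0, (-1), 0, 147, (-757)⟩)
    (htam : ¬ 3 ∣ W.tamagawaProduct)
    (hL : ∃ q : ℚ, q ≠ 0 ∧ W.entireLFunction 1 / (W.realPeriodRat : ℂ) = (q : ℂ) ∧ padicValRat 3 q = 0)
    (hSel : Nat.card (W.selmerGroupPInfty 3) = 1) :
    MazurMainConjecture W 3 :=
  haveI : Fact (Nat.Prime 7) := ⟨by norm_num⟩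
  mazurMainConjecture_three_of_ainvs_of_trivialArithmetic hkato hGr h5 h3 0 (-1) 0 147 (-757) hI
    7 5 2 (by decide +kernel) card_u131648bi1_3 (by decide) (by decide) (by decide) (by decide +kernel)
    card_u131648bi1_7 (by decide +kernel) htam hL hSel

/-! ### `132496bh1` (3Ns, N = 132496) -/

/-- `#Ẽ(𝔽_{3}) = 5` (`a₃ = -1`: good ORDINARY and NON-ANOMALOUS at `3`) for Cremona's model `132496bh1` (kernel count). [folklore] -/
theorem card_u132496bh1_3 :
    Nat.card (((⟨0, (-1), 0, 2336, (-133888)⟩ : WeierstrassCurve ℤ).map (Int.castRingHom (ZMod 3))).toAffine.Point) = 5 := by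
  rw [@WeierstrassCurve.natCard_point_eq_one_add_card (ZMod 3) (@ZMod.instField 3 ⟨by norm_num⟩) _ _ _
    (by decide +kernel), @card_sol_eq_sum_euler (ZMod 3) (@ZMod.instField 3 ⟨by norm_num⟩) _ _
    (by rw [ZMod.ringChar_zmod_n]; decide), ZMod.card]
  decide +kernel

/-- `#Ẽ(𝔽_{19}) = 26` (`a_{19} = -6`; `X² − a_{19}X + 19` root-free mod `3`) for Cremona's model `132496bh1` (kernel count). [folklore] -/
theorem card_u132496bh1_19 :
    Nat.card (((⟨0, (-1), 0, 2336, (-133888)⟩ : WeierstrassCurve ℤ).map (Int.castRingHom (ZMod 19))).toAffine.Point) = 26 := by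
  rw [@WeierstrassCurve.natCard_point_eq_one_add_card (ZMod 19) (@ZMod.instField 19 ⟨by norm_num⟩) _ _ _
    (by decide +kernel), @card_sol_eq_sum_euler (ZMod 19) (@ZMod.instField 19 ⟨by norm_num⟩) _ _
    (by rw [ZMod.ringChar_zmod_n]; decide), ZMod.card]
  decide +kernel

/-- **X_A3 AT THE PAIR `(132496bh1, 3)` by the UNIT ROAD: `MazurMainConjecture W 3`.** Cremona model
`[0, -1, 0, 2336, -133888]`, `N = 132496 = 2^4 · 7^2 · 13^2`; census image `Ns` (split Cartan normaliser `3Ns`); `#Ẽ(𝔽₃) = 5`, `a₃ = -1` (good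
ORDINARY, NON-ANOMALOUS); Frobenius witness `ℓ = 19`: `#Ẽ(𝔽_{19}) = 26`, `a_{19} = -6`, `X² − a_{19}X + 19`
root-free mod `3` (`E[3]` irreducible). Cremona `allbsd`: analytic rank `0`, `#E(ℚ)_tors = 1`,
`∏ c_ℓ = 4`, `#Ш_an = 1` (so `L(E,1)/Ω_E = 4`, a `3`-adic unit); not among the 257 lane-open cells of the g19 closure map (closed earlier by the lane) — a cell of record of N2 all the same. Displayed binders: PUBLISHED
`hkato`, `hGr`, `h5`, `h3`; census `htam`, `hL`, `hSel`. Per pair; the class-level statement stays OPEN;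
nothing booked. [cite: Kato2004Asterisque, Thm. 17.4 (1) (p. 273)] [cite: GreenbergLNM1716, Thm. 4.1 (p. 102) and Prop. 3.8 (p. 95)]
[cite: Mazur1978, §6 Prop. 6.3 (1) (p. 153)] [cite: Cremona2006, Table 1 (Cremona label 132496bh1)] -/
theorem mazurMainConjecture_unit_u132496bh1
    (hkato : ∀ (W : WeierstrassCurve ℚ) [W.IsElliptic] [W.IsGloballyMinimal] (p : ℕ) [Fact p.Prime]
      (κ : ZpExtension ℚ p) (γ : Field.absoluteGaloisGroup ℚ) (N : ℕ) [NeZero N]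
      (f : CuspForm (Gamma0 N) 2), kato_divisibility W p (κ := κ) (γ := γ) (f := f))
    (hGr : greenberg_charValue_rankZero) (h5 : realPeriodRat_eq_unit_mul_plusPeriod)
    (h3 : realPeriodRat_eq_unit_mul_plusPeriod_three)
    (W : WeierstrassCurve ℚ) [W.IsElliptic] [W.IsGloballyMinimal] [Fact (Nat.Prime 3)]
    (hI : integralModelInt W = ⟨0, (-1), 0, 2336, (-133888)⟩)
    (htam : ¬ 3 ∣ W.tamagawaProduct)
    (hL : ∃ q : ℚ, q ≠ 0 ∧ W.entireLFunction 1 / (W.realPeriodRat : ℂ) = (q : ℂ) ∧ padicValRat 3 q = 0)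
    (hSel : Nat.card (W.selmerGroupPInfty 3) = 1) :
    MazurMainConjecture W 3 :=
  haveI : Fact (Nat.Prime 19) := ⟨by norm_num⟩
  mazurMainConjecture_three_of_ainvs_of_trivialArithmetic hkato hGr h5 h3 0 (-1) 0 2336 (-133888) hI
    19 26 5 (by decide +kernel) card_u132496bh1_3 (by decide) (by decide) (by decide) (by decide +kernel)
    card_u132496bh1_19 (by decide +kernel) htam hL hSel

/-! ### `132496v1` (3Ns, N = 132496) -/

/-- `#Ẽ(𝔽_{3}) = 5` (`a₃ = -1`: good ORDINARY and NON-ANOMALOUS at `3`) for Cremona's model `132496v1` (kernel count). [folklore] -/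
theorem card_u132496v1_3 :
    Nat.card (((⟨0, (-1), 0, 394728, (-292572944)⟩ : WeierstrassCurve ℤ).map (Int.castRingHom (ZMod 3))).toAffine.Point) = 5 := by
  rw [@WeierstrassCurve.natCard_point_eq_one_add_card (ZMod 3) (@ZMod.instField 3 ⟨by norm_num⟩) _ _ _
    (by decide +kernel), @card_sol_eq_sum_euler (ZMod 3) (@ZMod.instField 3 ⟨by norm_num⟩) _ _
    (by rw [ZMod.ringChar_zmod_n]; decide), ZMod.card]
  decide +kernel

/-- `#Ẽ(𝔽_{19}) = 14` (`a_{19} = 6`; `X² − a_{19}X + 19` root-free mod `3`) for Cremona's model `132496v1` (kernel count). [folklore] -/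
theorem card_u132496v1_19 :
    Nat.card (((⟨0, (-1), 0, 394728, (-292572944)⟩ : WeierstrassCurve ℤ).map (Int.castRingHom (ZMod 19))).toAffine.Point) = 14 := by
  rw [@WeierstrassCurve.natCard_point_eq_one_add_card (ZMod 19) (@ZMod.instField 19 ⟨by norm_num⟩) _ _ _
    (by decide +kernel), @card_sol_eq_sum_euler (ZMod 19) (@ZMod.instField 19 ⟨by norm_num⟩) _ _
    (by rw [ZMod.ringChar_zmod_n]; decide), ZMod.card]
  decide +kernel

/-- **X_A3 AT THE PAIR `(132496v1, 3)` by the UNIT ROAD: `MazurMainConjecture W 3`.** Cremona model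
`[0, -1, 0, 394728, -292572944]`, `N = 132496 = 2^4 · 7^2 · 13^2`; census image `Ns` (split Cartan normaliser `3Ns`); `#Ẽ(𝔽₃) = 5`, `a₃ = -1` (good
ORDINARY, NON-ANOMALOUS); Frobenius witness `ℓ = 19`: `#Ẽ(𝔽_{19}) = 14`, `a_{19} = 6`, `X² − a_{19}X + 19`
root-free mod `3` (`E[3]` irreducible). Cremona `allbsd`: analytic rank `0`, `#E(ℚ)_tors = 1`,
`∏ c_ℓ = 8`, `#Ш_an = 1` (so `L(E,1)/Ω_E = 8`, a `3`-adic unit); not among the 257 lane-open cells of the g19 closure map (closed earlier by the lane) — a cell of record of N2 all the same. Displayed binders: PUBLISHED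
`hkato`, `hGr`, `h5`, `h3`; census `htam`, `hL`, `hSel`. Per pair; the class-level statement stays OPEN;
nothing booked. [cite: Kato2004Asterisque, Thm. 17.4 (1) (p. 273)] [cite: GreenbergLNM1716, Thm. 4.1 (p. 102) and Prop. 3.8 (p. 95)]
[cite: Mazur1978, §6 Prop. 6.3 (1) (p. 153)] [cite: Cremona2006, Table 1 (Cremona label 132496v1)] -/
theorem mazurMainConjecture_unit_u132496v1
    (hkato : ∀ (W : WeierstrassCurve ℚ) [W.IsElliptic] [W.IsGloballyMinimal] (p : ℕ) [Fact p.Prime]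
      (κ : ZpExtension ℚ p) (γ : Field.absoluteGaloisGroup ℚ) (N : ℕ) [NeZero N]
      (f : CuspForm (Gamma0 N) 2), kato_divisibility W p (κ := κ) (γ := γ) (f := f))
    (hGr : greenberg_charValue_rankZero) (h5 : realPeriodRat_eq_unit_mul_plusPeriod)
    (h3 : realPeriodRat_eq_unit_mul_plusPeriod_three)
    (W : WeierstrassCurve ℚ) [W.IsElliptic] [W.IsGloballyMinimal] [Fact (Nat.Prime 3)]
    (hI : integralModelInt W = ⟨0, (-1), 0, 394728, (-292572944)⟩)
    (htam : ¬ 3 ∣ W.tamagawaProduct)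
    (hL : ∃ q : ℚ, q ≠ 0 ∧ W.entireLFunction 1 / (W.realPeriodRat : ℂ) = (q : ℂ) ∧ padicValRat 3 q = 0)
    (hSel : Nat.card (W.selmerGroupPInfty 3) = 1) :
    MazurMainConjecture W 3 :=
  haveI : Fact (Nat.Prime 19) := ⟨by norm_num⟩
  mazurMainConjecture_three_of_ainvs_of_trivialArithmetic hkato hGr h5 h3 0 (-1) 0 394728 (-292572944) hI
    19 14 5 (by decide +kernel) card_u132496v1_3 (by decide) (by decide) (by decide) (by decide +kernel)
    card_u132496v1_19 (by decide +kernel) htam hL hSel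

/-! ### `148382l1` (3Ns, N = 148382) -/

/-- `#Ẽ(𝔽_{3}) = 2` (`a₃ = 2`: good ORDINARY and NON-ANOMALOUS at `3`) for Cremona's model `148382l1` (kernel count). [folklore] -/
theorem card_u148382l1_3 :
    Nat.card (((⟨1, 1, 0, (-35041646), (-79855294852)⟩ : WeierstrassCurve ℤ).map (Int.castRingHom (ZMod 3))).toAffine.Point) = 2 := by
  rw [@WeierstrassCurve.natCard_point_eq_one_add_card (ZMod 3) (@ZMod.instField 3 ⟨by norm_num⟩) _ _ _
    (by decide +kernel), @card_sol_eq_sum_euler (ZMod 3) (@ZMod.instField 3 ⟨by norm_num⟩) _ _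
    (by rw [ZMod.ringChar_zmod_n]; decide), ZMod.card]
  decide +kernel

/-- `#Ẽ(𝔽_{7}) = 5` (`a_{7} = 3`; `X² − a_{7}X + 7` root-free mod `3`) for Cremona's model `148382l1` (kernel count). [folklore] -/
theorem card_u148382l1_7 :
    Nat.card (((⟨1, 1, 0, (-35041646), (-79855294852)⟩ : WeierstrassCurve ℤ).map (Int.castRingHom (ZMod 7))).toAffine.Point) = 5 := by
  rw [@WeierstrassCurve.natCard_point_eq_one_add_card (ZMod 7) (@ZMod.instField 7 ⟨by norm_num⟩) _ _ _
    (by decide +kernel), @card_sol_eq_sum_euler (ZMod 7) (@ZMod.instField 7 ⟨by norm_num⟩) _ _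
    (by rw [ZMod.ringChar_zmod_n]; decide), ZMod.card]
  decide +kernel

/-- **X_A3 AT THE PAIR `(148382l1, 3)` by the UNIT ROAD: `MazurMainConjecture W 3`.** Cremona model
`[1, 1, 0, -35041646, -79855294852]`, `N = 148382 = 2 · 13^2 · 439`; census image `Ns` (split Cartan normaliser `3Ns`); `#Ẽ(𝔽₃) = 2`, `a₃ = 2` (good
ORDINARY, NON-ANOMALOUS); Frobenius witness `ℓ = 7`: `#Ẽ(𝔽_{7}) = 5`, `a_{7} = 3`, `X² − a_{7}X + 7`
root-free mod `3` (`E[3]` irreducible). Cremona `allbsd`: analytic rank `0`, `#E(ℚ)_tors = 1`,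
`∏ c_ℓ = 2`, `#Ш_an = 49` (so `L(E,1)/Ω_E = 98`, a `3`-adic unit); not among the 257 lane-open cells of the g19 closure map (closed earlier by the lane) — a cell of record of N2 all the same. Displayed binders: PUBLISHED
`hkato`, `hGr`, `h5`, `h3`; census `htam`, `hL`, `hSel`. Per pair; the class-level statement stays OPEN;
nothing booked. [cite: Kato2004Asterisque, Thm. 17.4 (1) (p. 273)] [cite: GreenbergLNM1716, Thm. 4.1 (p. 102) and Prop. 3.8 (p. 95)]
[cite: Mazur1978, §6 Prop. 6.3 (1) (p. 153)] [cite: Cremona2006, Table 1 (Cremona label 148382l1)] -/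
theorem mazurMainConjecture_unit_u148382l1
    (hkato : ∀ (W : WeierstrassCurve ℚ) [W.IsElliptic] [W.IsGloballyMinimal] (p : ℕ) [Fact p.Prime]
      (κ : ZpExtension ℚ p) (γ : Field.absoluteGaloisGroup ℚ) (N : ℕ) [NeZero N]
      (f : CuspForm (Gamma0 N) 2), kato_divisibility W p (κ := κ) (γ := γ) (f := f))
    (hGr : greenberg_charValue_rankZero) (h5 : realPeriodRat_eq_unit_mul_plusPeriod)
    (h3 : realPeriodRat_eq_unit_mul_plusPeriod_three)
    (W : WeierstrassCurve ℚ) [W.IsElliptic] [W.IsGloballyMinimal] [Fact (Nat.Prime 3)]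
    (hI : integralModelInt W = ⟨1, 1, 0, (-35041646), (-79855294852)⟩)
    (htam : ¬ 3 ∣ W.tamagawaProduct)
    (hL : ∃ q : ℚ, q ≠ 0 ∧ W.entireLFunction 1 / (W.realPeriodRat : ℂ) = (q : ℂ) ∧ padicValRat 3 q = 0)
    (hSel : Nat.card (W.selmerGroupPInfty 3) = 1) :
    MazurMainConjecture W 3 :=
  haveI : Fact (Nat.Prime 7) := ⟨by norm_num⟩
  mazurMainConjecture_three_of_ainvs_of_trivialArithmetic hkato hGr h5 h3 1 1 0 (-35041646) (-79855294852) hI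
    7 5 2 (by decide +kernel) card_u148382l1_3 (by decide) (by decide) (by decide) (by decide +kernel)
    card_u148382l1_7 (by decide +kernel) htam hL hSel

/-! ### `149248c1` (3Ns, N = 149248) -/

/-- `#Ẽ(𝔽_{3}) = 5` (`a₃ = -1`: good ORDINARY and NON-ANOMALOUS at `3`) for Cremona's model `149248c1` (kernel count). [folklore] -/
theorem card_u149248c1_3 :
    Nat.card (((⟨0, (-1), 0, (-659), (-16433)⟩ : WeierstrassCurve ℤ).map (Int.castRingHom (ZMod 3))).toAffine.Point) = 5 := by
  rw [@WeierstrassCurve.natCard_point_eq_one_add_card (ZMod 3) (@ZMod.instField 3 ⟨by norm_num⟩) _ _ _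
    (by decide +kernel), @card_sol_eq_sum_euler (ZMod 3) (@ZMod.instField 3 ⟨by norm_num⟩) _ _
    (by rw [ZMod.ringChar_zmod_n]; decide), ZMod.card]
  decide +kernel

/-- `#Ẽ(𝔽_{7}) = 8` (`a_{7} = 0`; `X² − a_{7}X + 7` root-free mod `3`) for Cremona's model `149248c1` (kernel count). [folklore] -/
theorem card_u149248c1_7 :
    Nat.card (((⟨0, (-1), 0, (-659), (-16433)⟩ : WeierstrassCurve ℤ).map (Int.castRingHom (ZMod 7))).toAffine.Point) = 8 := by
  rw [@WeierstrassCurve.natCard_point_eq_one_add_card (ZMod 7) (@ZMod.instField 7 ⟨by norm_num⟩) _ _ _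
    (by decide +kernel), @card_sol_eq_sum_euler (ZMod 7) (@ZMod.instField 7 ⟨by norm_num⟩) _ _
    (by rw [ZMod.ringChar_zmod_n]; decide), ZMod.card]
  decide +kernel

/-- **X_A3 AT THE PAIR `(149248c1, 3)` by the UNIT ROAD: `MazurMainConjecture W 3`.** Cremona model
`[0, -1, 0, -659, -16433]`, `N = 149248 = 2^8 · 11 · 53`; census image `Ns` (split Cartan normaliser `3Ns`); `#Ẽ(𝔽₃) = 5`, `a₃ = -1` (good
ORDINARY, NON-ANOMALOUS); Frobenius witness `ℓ = 7`: `#Ẽ(𝔽_{7}) = 8`, `a_{7} = 0`, `X² − a_{7}X + 7`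
root-free mod `3` (`E[3]` irreducible). Cremona `allbsd`: analytic rank `0`, `#E(ℚ)_tors = 1`,
`∏ c_ℓ = 2`, `#Ш_an = 4` (so `L(E,1)/Ω_E = 8`, a `3`-adic unit); not among the 257 lane-open cells of the g19 closure map (closed earlier by the lane) — a cell of record of N2 all the same. Displayed binders: PUBLISHED
`hkato`, `hGr`, `h5`, `h3`; census `htam`, `hL`, `hSel`. Per pair; the class-level statement stays OPEN;
nothing booked. [cite: Kato2004Asterisque, Thm. 17.4 (1) (p. 273)] [cite: GreenbergLNM1716, Thm. 4.1 (p. 102) and Prop. 3.8 (p. 95)]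
[cite: Mazur1978, §6 Prop. 6.3 (1) (p. 153)] [cite: Cremona2006, Table 1 (Cremona label 149248c1)] -/
theorem mazurMainConjecture_unit_u149248c1
    (hkato : ∀ (W : WeierstrassCurve ℚ) [W.IsElliptic] [W.IsGloballyMinimal] (p : ℕ) [Fact p.Prime]
      (κ : ZpExtension ℚ p) (γ : Field.absoluteGaloisGroup ℚ) (N : ℕ) [NeZero N]
      (f : CuspForm (Gamma0 N) 2), kato_divisibility W p (κ := κ) (γ := γ) (f := f))
    (hGr : greenberg_charValue_rankZero) (h5 : realPeriodRat_eq_unit_mul_plusPeriod)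
    (h3 : realPeriodRat_eq_unit_mul_plusPeriod_three)
    (W : WeierstrassCurve ℚ) [W.IsElliptic] [W.IsGloballyMinimal] [Fact (Nat.Prime 3)]
    (hI : integralModelInt W = ⟨0, (-1), 0, (-659), (-16433)⟩)
    (htam : ¬ 3 ∣ W.tamagawaProduct)
    (hL : ∃ q : ℚ, q ≠ 0 ∧ W.entireLFunction 1 / (W.realPeriodRat : ℂ) = (q : ℂ) ∧ padicValRat 3 q = 0)
    (hSel : Nat.card (W.selmerGroupPInfty 3) = 1) :
    MazurMainConjecture W 3 :=
  haveI : Fact (Nat.Prime 7) := ⟨by norm_num⟩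
  mazurMainConjecture_three_of_ainvs_of_trivialArithmetic hkato hGr h5 h3 0 (-1) 0 (-659) (-16433) hI
    7 8 5 (by decide +kernel) card_u149248c1_3 (by decide) (by decide) (by decide) (by decide +kernel)
    card_u149248c1_7 (by decide +kernel) htam hL hSel

end Summit.BirchSwinnertonDyer.Rank1Residual.X10.UnitRoad
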